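import Summits.ResolutionOfSingularities.ResolutionOfSingularities.Theorems.RisoStrataRtdUpperSemicontinuous

/-!
# Route RisoStrata — `RtdUpperSemicontinuous` (stmt-ResolutionOfSingularities-18552), part 2:
# typed riso-triviality dimension ≤ embedding dimension; reduction of the item to its slices `1 ≤ r ≤ N`

Continuation of `RisoStrataRtdUpperSemicontinuous.lean` (the `r = 0` slice).
* `rtd_le_of_span_sup_sq_eq` — `Rtd B m r → r ≤ #g'` for every tuple `g'` spanning `m` modulo `m²`: the
  typed riso-triviality dimension is at most `dim_k m/m²` (the Zariski-tangent-space half of Monreal,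
  arXiv:2606.12554, Thm 1.2 `rtd_x ≤ dim_x X`, for the route's encoding over `k((t^ℚ))`). Mechanism:
  translating the straightened constant arc by `t·u`, `u ∈ W`, yields arcs `b_u` with
  `b_u(g_i) = u_i t + O(t^{>1})`; the degree-one coefficient of `b_u` on `m` is a `k`-linear functional
  killing `m²` with value `u_i` on `g_i`, whence an injective linear map `W → k^{#g'}`.
* `rtdUpperSemicontinuous_of_numGenerators_lt` — the slices `r > N` of the route decl are vacuous when `B`
  is generated by `N` elements; `rtdUpperSemicontinuous_of_slices` — the route decl follows from its
  slices `1 ≤ r ≤ N` alone (Monreal's printed open Question 6.4 in characteristic `p`; NOT proved here).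
NB: Mathlib synthesises `Algebra k (HahnSeries ℚ k)` as `HahnSeries.powerSeriesAlgebra`
(`algHom_algebraMap_eq_C`).
-/

noncomputable section

set_option linter.dupNamespace false -- mandated namespace of this single-conjunct summit

namespace Summit.ResolutionOfSingularities.ResolutionOfSingularities.Theorems

open Summit.ResolutionOfSingularities.ResolutionOfSingularities.Theses.RisoStrata

/-! ### Small Hahn-series valuation lemmas -/

section HahnLemmas

variable {k : Type} [Field k]

/-- A strict lower bound on the orders of two Hahn series bounds the order of their sum. [folklore] -/
theorem lt_orderTop_add {c : WithTop ℚ} {x y : HahnSeries ℚ k} (hx : c < x.orderTop)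
    (hy : c < y.orderTop) : c < (x + y).orderTop :=
  lt_of_lt_of_le (lt_min hx hy) HahnSeries.min_orderTop_le_orderTop_add

/-- A lower bound on the orders of two Hahn series bounds the order of their sum. [folklore] -/
theorem le_orderTop_add {c : WithTop ℚ} {x y : HahnSeries ℚ k} (hx : c ≤ x.orderTop)
    (hy : c ≤ y.orderTop) : c ≤ (x + y).orderTop :=
  le_trans (le_min hx hy) HahnSeries.min_orderTop_le_orderTop_add

/-- A strict lower bound `c < ⊤` on the orders of finitely many Hahn series bounds the order of their sum.
[folklore] -/
theorem lt_orderTop_sum {ι : Type} {c : ℚ} (s : Finset ι) (f : ι → HahnSeries ℚ k)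
    (h : ∀ i ∈ s, (c : WithTop ℚ) < (f i).orderTop) : (c : WithTop ℚ) < (∑ i ∈ s, f i).orderTop :=
  Finset.sum_induction f (fun x => (c : WithTop ℚ) < x.orderTop) (fun _ _ => lt_orderTop_add)
    (by simp) h

/-- A lower bound `c < ⊤` on the orders of finitely many Hahn series bounds the order of their sum.
[folklore] -/
theorem le_orderTop_sum {ι : Type} {c : ℚ} (s : Finset ι) (f : ι → HahnSeries ℚ k)
    (h : ∀ i ∈ s, (c : WithTop ℚ) ≤ (f i).orderTop) : (c : WithTop ℚ) ≤ (∑ i ∈ s, f i).orderTop :=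
  Finset.sum_induction f (fun x => (c : WithTop ℚ) ≤ x.orderTop) (fun _ _ => le_orderTop_add)
    (by simp) h

/-- A Hahn series of order `≥ 1` whose coefficient in degree `1` vanishes has order `> 1`. [folklore] -/
theorem one_lt_orderTop_of_coeff_one_eq_zero {y : HahnSeries ℚ k} (h1 : (1 : WithTop ℚ) ≤ y.orderTop)
    (h0 : y.coeff 1 = 0) : (1 : WithTop ℚ) < y.orderTop := by
  rcases h1.lt_or_eq with h | h
  · exact h
  · exact absurd h0 (HahnSeries.coeff_orderTop_ne h.symm)

/-- `coeff 1 (C c * x) = c * coeff 1 x`. [folklore] -/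
theorem coeff_C_mul (c : k) (x : HahnSeries ℚ k) (q : ℚ) : (HahnSeries.C c * x).coeff q = c * x.coeff q := by
  rw [HahnSeries.C_mul_eq_smul, HahnSeries.coeff_smul, smul_eq_mul]

end HahnLemmas

/-! ### The embedding-dimension bound -/

section Edim

variable {k K : Type} [Field k] [IsAlgClosed k] [Field K] [Algebra k K]

/-- Evaluation at a `k`-rational maximal ideal: for a finitely generated subalgebra `B ⊆ K` over an
algebraically closed `k` and a maximal ideal `m`, there is a `k`-algebra map `ψ : B → k` with `x - ψ x ∈ m` for
all `x` (so `ker ψ = m`). [folklore] -/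
theorem exists_evalAlgHom_of_isMaximal (B : Subalgebra k K) (hB : B.FG) (m : Ideal ↥B) [hm : m.IsMaximal] :
    ∃ ψ : ↥B →ₐ[k] k, ∀ x, x - algebraMap k ↥B (ψ x) ∈ m := by
  haveI : Algebra.FiniteType k ↥B := (Subalgebra.fg_iff_finiteType B).mp hB
  letI : Field (↥B ⧸ m) := Ideal.Quotient.field m
  haveI : Module.Finite k (↥B ⧸ m) := finite_of_finite_type_of_isJacobsonRing k (↥B ⧸ m)
  haveI : Algebra.IsIntegral k (↥B ⧸ m) := Algebra.IsIntegral.of_finite k _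
  have hbij := IsAlgClosed.algebraMap_bijective_of_isIntegral (k := k) (K := ↥B ⧸ m)
  let e : k ≃ₐ[k] (↥B ⧸ m) := AlgEquiv.ofBijective (Algebra.ofId k (↥B ⧸ m)) hbij
  refine ⟨e.symm.toAlgHom.comp (Ideal.Quotient.mkₐ k m), fun x => ?_⟩
  rw [← Ideal.Quotient.eq_zero_iff_mem, map_sub, sub_eq_zero, Ideal.Quotient.mk_algebraMap]
  change Ideal.Quotient.mk m x = algebraMap k (↥B ⧸ m) (e.symm (Ideal.Quotient.mk m x))
  have : algebraMap k (↥B ⧸ m) (e.symm (Ideal.Quotient.mk m x)) =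
      e (e.symm (Ideal.Quotient.mk m x)) := rfl
  rw [this, AlgEquiv.apply_symm_apply]

omit [IsAlgClosed k] in
/-- A `k`-algebra map `B → k((t^ℚ))` sends the scalar `c` to the constant Hahn series `C c` (stated for the
`Algebra k (HahnSeries ℚ k)` instance that elaborates under `import Mathlib`, `HahnSeries.powerSeriesAlgebra`).
[folklore] -/
theorem algHom_algebraMap_eq_C {B : Type} [CommRing B] [Algebra k B] (a : B →ₐ[k] HahnSeries ℚ k) (c : k) :
    a (algebraMap k B c) = HahnSeries.C c := by
  rw [AlgHom.commutes, HahnSeries.algebraMap_apply', PowerSeries.algebraMap_apply, Algebra.algebraMap_self,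
    RingHom.id_apply, HahnSeries.ofPowerSeries_C]

omit [IsAlgClosed k] in
/-- The evaluation map of `exists_evalAlgHom_of_isMaximal` kills `m`. [folklore] -/
theorem eval_eq_zero_of_mem {B : Subalgebra k K} {m : Ideal ↥B} [hm : m.IsMaximal] {ψ : ↥B →ₐ[k] k}
    (hψ : ∀ x, x - algebraMap k ↥B (ψ x) ∈ m) : ∀ x ∈ m, ψ x = 0 := by
  intro x hx
  by_contra hne
  have hmem : algebraMap k ↥B (ψ x) ∈ m := by simpa using m.sub_mem hx (hψ x)
  exact hm.ne_top (m.eq_top_of_isUnit_mem hmem ((IsUnit.mk0 _ hne).map _))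

/-- If generators `g i ∈ m` of `B` (as a subalgebra of `K`) are given, then `m` is the ideal they span.
[folklore] -/
theorem span_range_eq_of_generators_mem (B : Subalgebra k K) (hB : B.FG) (m : Ideal ↥B)
    [hm : m.IsMaximal] {n : ℕ} (g : Fin n → ↥B) (hg : ∀ i, g i ∈ m)
    (hgen : Algebra.adjoin k (Set.range fun i => (g i : K)) = B) :
    Ideal.span (Set.range g) = m := by
  obtain ⟨ψ, hψ⟩ := exists_evalAlgHom_of_isMaximal B hB m
  have hψm := eval_eq_zero_of_mem hψ
  apply le_antisymm (Ideal.span_le.mpr (by rintro _ ⟨i, rfl⟩; exact hg i))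
  intro x hx
  have hall : ∀ y : ↥B, y - algebraMap k ↥B (ψ y) ∈ Ideal.span (Set.range g) := by
    intro y
    have hy : y ∈ Algebra.adjoin k (Set.range g) := by
      rw [adjoin_range_eq_top_of_adjoin_coe_eq B g hgen]; trivial
    refine Algebra.adjoin_induction (p := fun y _ => y - algebraMap k ↥B (ψ y) ∈ Ideal.span (Set.range g))
      ?_ ?_ ?_ ?_ hy
    · rintro _ ⟨i, rfl⟩
      rw [hψm _ (hg i), map_zero, sub_zero]
      exact Ideal.subset_span ⟨i, rfl⟩
    · intro c
      rw [AlgHom.commutes, Algebra.algebraMap_self, RingHom.id_apply, sub_self]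
      exact zero_mem _
    · intro y z _ _ hy hz
      rw [map_add, map_add]
      convert add_mem hy hz using 1
      ring
    · intro y z _ _ hy hz
      rw [map_mul, map_mul]
      have : y * z - algebraMap k ↥B (ψ y) * algebraMap k ↥B (ψ z) =
          y * (z - algebraMap k ↥B (ψ z)) + algebraMap k ↥B (ψ z) * (y - algebraMap k ↥B (ψ y)) := by
        ring
      rw [this]
      exact add_mem (Ideal.mul_mem_left _ _ hz) (Ideal.mul_mem_left _ _ hy)
  have := hall x
  rwa [hψm x hx, map_zero, sub_zero] at this

/-- **Typed riso-triviality dimension ≤ embedding dimension** (the Zariski-tangent-space half of Monreal,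
arXiv:2606.12554, Thm 1.2 `rtd_x ≤ dim`, for route RisoStrata's encoding). If `Rtd B m r` holds (let-expanded
verbatim from the route file) and `g'` is any tuple of elements of `B` spanning `m` modulo `m²`, then `r` is at
most the length of `g'`. Proof: translating the straightened constant arc by `t·u`, `u ∈ W`, produces arcs
`b_u` with `b_u(g_i) = u_i t + (order > 1)`; the degree-one coefficient of `b_u` on `m` is a `k`-linear functional
vanishing on `m²` and taking the value `u_i` on `g_i`, so `u ↦ (coeff₁ b_u(g'_j))_j` is an injective linear
map `W → k^{n'}`. [folklore] -/
theorem rtd_le_of_span_sup_sq_eq (B : Subalgebra k K) (hB : B.FG) (m : Ideal ↥B) [hm : m.IsMaximal]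
    (r : ℕ) (hRtd : ∃ (n : ℕ) (g : Fin n → ↥B), (∀ i, g i ∈ m) ∧ Algebra.adjoin k (Set.range fun i => (g i : K)) = B ∧
      ∃ W : Submodule k (Fin n → k), r ≤ Module.finrank k ↥W ∧
        ∃ φ : {α : ↥B →ₐ[k] HahnSeries ℚ k // ∀ b ∈ m, 0 < (α b).orderTop} → (Fin n → HahnSeries ℚ k),
          (∀ a b : {α : ↥B →ₐ[k] HahnSeries ℚ k // ∀ b ∈ m, 0 < (α b).orderTop}, a ≠ b →
              ∃ j, ∀ i, (a.1 (g j) - b.1 (g j)).orderTop <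
                ((φ a i - φ b i) - (a.1 (g i) - b.1 (g i))).orderTop) ∧
          (∀ a i, 0 < (φ a i).orderTop) ∧
          (∀ a, ∀ w : Fin n → HahnSeries ℚ k, (∀ i, 0 < (w i).orderTop) →
              w ∈ Submodule.span (HahnSeries ℚ k)
                ((fun u : Fin n → k => fun i => HahnSeries.C (u i)) '' (W : Set (Fin n → k))) →
                ∃ b, φ b = φ a + w))
    {n' : ℕ} (g' : Fin n' → ↥B) (hg' : Ideal.span (Set.range g') ⊔ m ^ 2 = m) : r ≤ n' := by
  classical
  obtain ⟨n, g, hg, hgen, W, hrW, φ, hrv, _, htr⟩ := hRtd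
  obtain ⟨ψ, hψ⟩ := exists_evalAlgHom_of_isMaximal B hB m
  have hψm := eval_eq_zero_of_mem hψ
  have hspan : Ideal.span (Set.range g) = m := span_range_eq_of_generators_mem B hB m g hg hgen
  -- the constant arc
  let a₀ : {α : ↥B →ₐ[k] HahnSeries ℚ k // ∀ b ∈ m, 0 < (α b).orderTop} :=
    ⟨(Algebra.ofId k (HahnSeries ℚ k)).comp ψ, fun b hb => by simp [AlgHom.comp_apply, hψm b hb]⟩
  have ha₀g : ∀ i, a₀.1 (g i) = 0 := fun i => by simp [a₀, AlgHom.comp_apply, hψm _ (hg i)]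
  -- arcs are integral
  have hint : ∀ (a : {α : ↥B →ₐ[k] HahnSeries ℚ k // ∀ b ∈ m, 0 < (α b).orderTop}) (x : ↥B),
      0 ≤ (a.1 x).orderTop := by
    intro a x
    have hx : x = algebraMap k ↥B (ψ x) + (x - algebraMap k ↥B (ψ x)) := by ring
    rw [hx, map_add, algHom_algebraMap_eq_C]
    refine le_orderTop_add ?_ (a.2 _ (hψ x)).le
    rw [HahnSeries.C_apply]
    exact HahnSeries.orderTop_single_le
  -- key: translating the constant arc by `t • u`
  have key : ∀ u ∈ W, ∃ b : {α : ↥B →ₐ[k] HahnSeries ℚ k // ∀ b ∈ m, 0 < (α b).orderTop},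
      ∀ i, (1 : WithTop ℚ) < (HahnSeries.single (1 : ℚ) (u i) - b.1 (g i)).orderTop := by
    intro u hu
    let w : Fin n → HahnSeries ℚ k := fun i => HahnSeries.single (1 : ℚ) (u i)
    have hw1 : ∀ i, 0 < (w i).orderTop := fun i =>
      HahnSeries.lt_orderTop_single (by norm_num : (0 : ℚ) < 1)
    have hw2 : w ∈ Submodule.span (HahnSeries ℚ k)
        ((fun u : Fin n → k => fun i => HahnSeries.C (u i)) '' (W : Set (Fin n → k))) := by
      have hw : w = (HahnSeries.single (1 : ℚ) (1 : k)) • (fun i => HahnSeries.C (u i)) := by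
        funext i
        simp only [w, Pi.smul_apply, smul_eq_mul, HahnSeries.C_apply, HahnSeries.single_mul_single,
          add_zero, one_mul]
      rw [hw]
      exact Submodule.smul_mem _ _ (Submodule.subset_span ⟨u, hu, rfl⟩)
    obtain ⟨b, hb⟩ := htr a₀ w hw1 hw2
    refine ⟨b, ?_⟩
    by_cases hba : b = a₀
    · have hw0 : w = 0 := by rw [hba] at hb; exact left_eq_add.mp hb
      intro i
      have hwi : HahnSeries.single (1 : ℚ) (u i) = 0 := congr_fun hw0 i
      rw [hwi, hba, ha₀g i, sub_zero, HahnSeries.orderTop_zero]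
      exact WithTop.coe_lt_top 1
    · obtain ⟨j, hj⟩ := hrv b a₀ hba
      have hj' : ∀ i, (b.1 (g j)).orderTop < (w i - b.1 (g i)).orderTop := by
        intro i
        have := hj i
        rwa [ha₀g, ha₀g, sub_zero, sub_zero, hb, Pi.add_apply, add_sub_cancel_left] at this
      have h1 : (w j).orderTop = (b.1 (g j)).orderTop := by
        have := HahnSeries.orderTop_add_eq_left (hj' j)
        rwa [add_sub_cancel] at this
      have h2 : (b.1 (g j)).orderTop < ⊤ := lt_of_lt_of_le (hj' j) le_top
      have h3 : u j ≠ 0 := by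
        intro h0
        apply h2.ne
        rw [← h1]
        simp [w, h0]
      have h4 : (b.1 (g j)).orderTop = 1 := by rw [← h1]; exact HahnSeries.orderTop_single h3
      intro i
      have := hj' i
      rwa [h4] at this
  -- consequences of `key` for such an arc `b`
  have hge1 : ∀ (u : Fin n → k) (b : {α : ↥B →ₐ[k] HahnSeries ℚ k // ∀ b ∈ m, 0 < (α b).orderTop}),
      (∀ i, (1 : WithTop ℚ) < (HahnSeries.single (1 : ℚ) (u i) - b.1 (g i)).orderTop) →
      ∀ x ∈ m, (1 : WithTop ℚ) ≤ (b.1 x).orderTop := by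
    intro u b hb x hx
    have hgi : ∀ i, (1 : WithTop ℚ) ≤ (b.1 (g i)).orderTop := by
      intro i
      have h1 : ((1 : ℚ) : WithTop ℚ) ≤ (HahnSeries.single (1 : ℚ) (u i)).orderTop :=
        HahnSeries.orderTop_single_le
      have := HahnSeries.min_orderTop_le_orderTop_sub (x := HahnSeries.single (1 : ℚ) (u i))
        (y := HahnSeries.single (1 : ℚ) (u i) - b.1 (g i))
      rw [sub_sub_cancel] at this
      exact le_trans (le_min h1 (hb i).le) this
    rw [← hspan, Ideal.mem_span_range_iff_exists_fun] at hx
    obtain ⟨c, rfl⟩ := hx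
    rw [map_sum]
    refine le_orderTop_sum _ _ fun i _ => ?_
    rw [map_mul, HahnSeries.orderTop_mul]
    exact le_add_of_nonneg_of_le (hint b (c i)) (hgi i)
  have hgt1 : ∀ (u : Fin n → k) (b : {α : ↥B →ₐ[k] HahnSeries ℚ k // ∀ b ∈ m, 0 < (α b).orderTop}),
      (∀ i, (1 : WithTop ℚ) < (HahnSeries.single (1 : ℚ) (u i) - b.1 (g i)).orderTop) →
      ∀ x ∈ m ^ 2, (1 : WithTop ℚ) < (b.1 x).orderTop := by
    intro u b hb x hx
    rw [pow_two] at hx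
    refine Submodule.mul_induction_on hx ?_ ?_
    · intro y hy z hz
      rw [map_mul, HahnSeries.orderTop_mul]
      have h12 : (1 : WithTop ℚ) < 1 + 1 := by
        rw [← WithTop.coe_one, ← WithTop.coe_add, WithTop.coe_lt_coe]; norm_num
      calc (1 : WithTop ℚ) < 1 + 1 := h12
        _ ≤ _ := add_le_add (hge1 u b hb y hy) (hge1 u b hb z hz)
    · intro y z hy hz
      rw [map_add]
      exact lt_orderTop_add hy hz
  have hcoeffg : ∀ (u : Fin n → k) (b : {α : ↥B →ₐ[k] HahnSeries ℚ k // ∀ b ∈ m, 0 < (α b).orderTop}),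
      (∀ i, (1 : WithTop ℚ) < (HahnSeries.single (1 : ℚ) (u i) - b.1 (g i)).orderTop) →
      ∀ i, (b.1 (g i)).coeff 1 = u i := by
    intro u b hb i
    have := HahnSeries.coeff_eq_zero_of_lt_orderTop (hb i)
    rw [HahnSeries.coeff_sub, HahnSeries.coeff_single_same, sub_eq_zero] at this
    exact this.symm
  have hcoeff : ∀ (u : Fin n → k) (b : {α : ↥B →ₐ[k] HahnSeries ℚ k // ∀ b ∈ m, 0 < (α b).orderTop}),
      (∀ i, (1 : WithTop ℚ) < (HahnSeries.single (1 : ℚ) (u i) - b.1 (g i)).orderTop) →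
      ∀ (x : ↥B) (d : Fin n → k), x - ∑ i, algebraMap k ↥B (d i) * g i ∈ m ^ 2 →
        (b.1 x).coeff 1 = ∑ i, d i * u i := by
    intro u b hb x d hx
    have h1 : (b.1 (x - ∑ i, algebraMap k ↥B (d i) * g i)).coeff 1 = 0 :=
      HahnSeries.coeff_eq_zero_of_lt_orderTop (hgt1 u b hb _ hx)
    rw [map_sub, HahnSeries.coeff_sub, sub_eq_zero, map_sum, HahnSeries.coeff_sum] at h1
    rw [h1]
    refine Finset.sum_congr rfl fun i _ => ?_
    rw [map_mul, algHom_algebraMap_eq_C, coeff_C_mul, hcoeffg u b hb i]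
  -- the matrix expressing `g'` through `g` modulo `m²`
  have hg'm : ∀ j, g' j ∈ m := fun j =>
    hg' ▸ Ideal.mem_sup_left (Ideal.subset_span ⟨j, rfl⟩)
  have hD : ∀ j, ∃ d : Fin n → k, g' j - ∑ i, algebraMap k ↥B (d i) * g i ∈ m ^ 2 := by
    intro j
    have hx := hg'm j
    rw [← hspan, Ideal.mem_span_range_iff_exists_fun] at hx
    obtain ⟨c, hc⟩ := hx
    refine ⟨fun i => ψ (c i), ?_⟩
    have : g' j - ∑ i, algebraMap k ↥B (ψ (c i)) * g i = ∑ i, (c i - algebraMap k ↥B (ψ (c i))) * g i := by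
      rw [← hc, ← Finset.sum_sub_distrib]
      refine Finset.sum_congr rfl fun i _ => ?_
      ring
    rw [this]
    refine Ideal.sum_mem _ fun i _ => ?_
    rw [pow_two]
    exact Ideal.mul_mem_mul (hψ (c i)) (hg i)
  choose D hD using hD
  -- the linear map `u ↦ (∑ i, D j i * u i)_j` is injective on `W`
  let Λ : (Fin n → k) →ₗ[k] (Fin n' → k) := Matrix.mulVecLin (Matrix.of D)
  have hΛ : ∀ u j, Λ u j = ∑ i, D j i * u i := fun u j => rfl
  have hinj : Function.Injective (Λ.comp W.subtype) := by
    rw [← LinearMap.ker_eq_bot, LinearMap.ker_eq_bot']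
    rintro ⟨u, hu⟩ hu0
    obtain ⟨b, hb⟩ := key u hu
    -- `coeff₁ b (g' j) = 0` for all `j`
    have hg'0 : ∀ j, (1 : WithTop ℚ) < (b.1 (g' j)).orderTop := by
      intro j
      refine one_lt_orderTop_of_coeff_one_eq_zero (hge1 u b hb _ (hg'm j)) ?_
      rw [hcoeff u b hb (g' j) (D j) (hD j), ← hΛ]
      exact congr_fun hu0 j
    -- hence `u i = coeff₁ b (g i) = 0`
    apply Subtype.ext
    funext i
    show u i = 0
    rw [← hcoeffg u b hb i]
    have hgi : g i ∈ Ideal.span (Set.range g') ⊔ m ^ 2 := by rw [hg']; exact hg i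
    obtain ⟨y, hy, z, hz, hyz⟩ := Submodule.mem_sup.mp hgi
    rw [← hyz, map_add, HahnSeries.coeff_add, HahnSeries.coeff_eq_zero_of_lt_orderTop (hgt1 u b hb z hz),
      add_zero]
    rw [Ideal.mem_span_range_iff_exists_fun] at hy
    obtain ⟨c, rfl⟩ := hy
    refine HahnSeries.coeff_eq_zero_of_lt_orderTop ?_
    rw [map_sum]
    refine lt_orderTop_sum _ _ fun j _ => ?_
    rw [map_mul, HahnSeries.orderTop_mul]
    exact lt_add_of_nonneg_of_lt (hint b (c j)) (hg'0 j)
  have hfin : Module.finrank k ↥W ≤ n' := by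
    have := LinearMap.finrank_le_finrank_of_injective hinj
    rwa [Module.finrank_fin_fun] at this
  exact hrW.trans hfin

/-- Re-centring a generating tuple at a `k`-rational maximal ideal: if `f : Fin N → K` generates `B`, then the
shifted tuple `f i - ψ(f i)` lies in `m` and still generates `B`. [folklore] -/
theorem exists_generators_mem_of_adjoin_eq (B : Subalgebra k K) (hB : B.FG) (m : Ideal ↥B) [hm : m.IsMaximal]
    {N : ℕ} (f : Fin N → K) (hf : Algebra.adjoin k (Set.range f) = B) :
    ∃ g : Fin N → ↥B, (∀ i, g i ∈ m) ∧ Algebra.adjoin k (Set.range fun i => (g i : K)) = B := by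
  obtain ⟨ψ, hψ⟩ := exists_evalAlgHom_of_isMaximal B hB m
  have hfB : ∀ i, f i ∈ B := fun i => hf ▸ Algebra.subset_adjoin ⟨i, rfl⟩
  refine ⟨fun i => ⟨f i, hfB i⟩ - algebraMap k ↥B (ψ ⟨f i, hfB i⟩), fun i => hψ _, ?_⟩
  apply le_antisymm
  · refine Algebra.adjoin_le ?_
    rintro _ ⟨i, rfl⟩
    exact SetLike.coe_mem _
  · intro x hx
    have hx' : x ∈ Algebra.adjoin k (Set.range f) := by rw [hf]; exact hx
    refine Algebra.adjoin_le ?_ hx'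
    rintro _ ⟨i, rfl⟩
    have h1 : f i = ((⟨f i, hfB i⟩ - algebraMap k ↥B (ψ ⟨f i, hfB i⟩) : ↥B) : K) +
        algebraMap k K (ψ ⟨f i, hfB i⟩) := by
      simp
    rw [h1]
    exact add_mem (Algebra.subset_adjoin ⟨i, rfl⟩) (Subalgebra.algebraMap_mem _ _)

/-- **The slices `r > N` of `RtdUpperSemicontinuous` are vacuous.** If `B` is generated by `N` elements then
`Rtd B m r` fails for every maximal `m` and every `r > N` (by `rtd_le_of_span_sup_sq_eq` applied to the
re-centred generators, which span `m`), so the openness statement holds trivially for such `r`. The `let`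
block is the route file's, verbatim. [folklore] -/
theorem rtdUpperSemicontinuous_of_numGenerators_lt : ∀ p : ℕ, p.Prime → ∀ (k : Type) [Field k] [CharP k p] [IsAlgClosed k] (K : Type) [Field K] [Algebra k K] (B : Subalgebra k K), B.FG → let Arc : ∀ (B : Subalgebra k K), Ideal ↥B → Type := fun B m => {α : ↥B →ₐ[k] HahnSeries ℚ k // ∀ b ∈ m, 0 < (α b).orderTop}; let Rtd : ∀ (B : Subalgebra k K), Ideal ↥B → ℕ → Prop := fun B m r => ∃ (n : ℕ) (g : Fin n → ↥B), (∀ i, g i ∈ m) ∧ Algebra.adjoin k (Set.range fun i => (g i : K)) = B ∧ ∃ W : Submodule k (Fin n → k), r ≤ Module.finrank k ↥W ∧ ∃ φ : Arc B m → (Fin n → HahnSeries ℚ k), (∀ a b : Arc B m, a ≠ b → ∃ j, ∀ i, (a.1 (g j) - b.1 (g j)).orderTop < ((φ a i - φ b i) - (a.1 (g i) - b.1 (g i))).orderTop) ∧ (∀ a i, 0 < (φ a i).orderTop) ∧ (∀ a, ∀ w : Fin n → HahnSeries ℚ k, (∀ i, 0 < (w i).orderTop) → w ∈ Submodule.span (HahnSeries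 ℚ k) ((fun u : Fin n → k => fun i => HahnSeries.C (u i)) '' (W : Set (Fin n → k))) → ∃ b, φ b = φ a + w); ∀ (N : ℕ) (f : Fin N → K), Algebra.adjoin k (Set.range f) = B → ∀ r : ℕ, N < r → ∀ (m : Ideal ↥B), m.IsMaximal → Rtd B m r → ∃ s : ↥B, s ∉ m ∧ ∀ (m'' : Ideal ↥B), m''.IsMaximal → s ∉ m'' → Rtd B m'' r := by
  intro p _ k _ _ _ K _ _ B hB Arc Rtd N f hf r hNr m hm hRtd
  exfalso
  obtain ⟨g', hg'm, hg'gen⟩ := exists_generators_mem_of_adjoin_eq B hB m f hf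
  have hspan : Ideal.span (Set.range g') ⊔ m ^ 2 = m := by
    rw [span_range_eq_of_generators_mem B hB m g' hg'm hg'gen]
    exact sup_eq_left.mpr (Ideal.pow_le_self two_ne_zero)
  have hle : r ≤ N := rtd_le_of_span_sup_sq_eq B hB m r hRtd g' hspan
  omega

/-- **Reduction of `RtdUpperSemicontinuous` to its slices `1 ≤ r ≤ N`.** The route decl follows from the
openness of `{Rtd ≥ r}` for `1 ≤ r ≤ N` only, where `N` is the length of ANY generating tuple of `B`: the slice
`r = 0` is `rtdUpperSemicontinuous_zero` and the slices `r > N` are vacuous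
(`rtdUpperSemicontinuous_of_numGenerators_lt`). The hypothesis is the route decl verbatim with `∀ r : ℕ,`
guarded by a generating tuple `f` and `1 ≤ r ≤ N`; it is Monreal's printed open Question 6.4
(arXiv:2606.12554, p. 25) in characteristic `p` for the route's encoding and is NOT proved here. [folklore] -/
theorem rtdUpperSemicontinuous_of_slices (h : ∀ p : ℕ, p.Prime → ∀ (k : Type) [Field k] [CharP k p] [IsAlgClosed k] (K : Type) [Field K] [Algebra k K] (B : Subalgebra k K), B.FG → let Arc : ∀ (B : Subalgebra k K), Ideal ↥B → Type := fun B m => {α : ↥B →ₐ[k] HahnSeries ℚ k // ∀ b ∈ m, 0 < (α b).orderTop}; let Rtd : ∀ (B : Subalgebra k K), Ideal ↥B → ℕ → Prop := fun B m r => ∃ (n : ℕ) (g : Fin n → ↥B), (∀ i, g i ∈ m) ∧ Algebra.adjoin k (Set.range fun i => (g i : K)) = B ∧ ∃ W : Submodule k (Fin n → k), r ≤ Module.finrank k ↥W ∧ ∃ φ : Arc B m → (Fin n → HahnSeries ℚ k), (∀ a b : Arc B m, a ≠ b → ∃ j, ∀ i, (a.1 (g j) - b.1 (g j)).orderTop <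 ((φ a i - φ b i) - (a.1 (g i) - b.1 (g i))).orderTop) ∧ (∀ a i, 0 < (φ a i).orderTop) ∧ (∀ a, ∀ w : Fin n → HahnSeries ℚ k, (∀ i, 0 < (w i).orderTop) → w ∈ Submodule.span (HahnSeries ℚ k) ((fun u : Fin n → k => fun i => HahnSeries.C (u i)) '' (W : Set (Fin n → k))) → ∃ b, φ b = φ a + w); ∀ (N : ℕ) (f : Fin N → K), Algebra.adjoin k (Set.range f) = B → ∀ r : ℕ, 1 ≤ r → r ≤ N → ∀ (m : Ideal ↥B), m.IsMaximal → Rtd B m r → ∃ s : ↥B, s ∉ m ∧ ∀ (m'' : Ideal ↥B), m''.IsMaximal → s ∉ m'' → Rtd B m'' r) :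
    RtdUpperSemicontinuous := by
  unfold RtdUpperSemicontinuous
  intro p hp k _ _ _ K _ _ B hB Arc Rtd r m hm hr
  classical
  obtain ⟨t, ht⟩ := id hB
  let f : Fin t.card → K := fun i => ((t.equivFin.symm i : { x // x ∈ t }) : K)
  have hf : Algebra.adjoin k (Set.range f) = B := by
    have hrange : Set.range f = (t : Set K) := by
      ext x
      constructor
      · rintro ⟨i, rfl⟩
        exact (t.equivFin.symm i).2
      · intro hx
        exact ⟨t.equivFin ⟨x, hx⟩, by simp [f]⟩
    rw [hrange, ht]
  rcases Nat.eq_zero_or_pos r with rfl | hr1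
  · exact rtdUpperSemicontinuous_zero p hp k K B hB m hm hr
  · by_cases hrN : r ≤ t.card
    · exact h p hp k K B hB t.card f hf r hr1 hrN m hm hr
    · exact rtdUpperSemicontinuous_of_numGenerators_lt p hp k K B hB t.card f hf r (by omega) m hm hr

end Edim

end Summit.ResolutionOfSingularities.ResolutionOfSingularities.Theorems
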